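import Mathlib
import Literature.NumberTheory.Transcendental.GammaFields
import Summits.Schanuel.Schanuel.Theorems.RigidCoreAclSubsetLogFreeCoreCaseIILstep
import Summits.Schanuel.Schanuel.Theorems.RigidCoreAclSubsetLogFreeCoreCaseIIShift
import Summits.Schanuel.Schanuel.Theorems.RigidCoreAclSubsetLogFreeCoreCaseIIMinpoly

/-!
# Case II core, file 9: semi-invariant affine kill — finite orbits at the bottom level
(helper file for the registered stub `stub_caseII_core` of line `eac-extends-core-automorphisms`,
crux stmt-Schanuel-0968 `Summit.Schanuel.Schanuel.Theses.RigidCore.AclSubsetLogFreeCore`)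

Let `θ` be an exponential ring automorphism fixing the rational subspace `X ∋ τ` pointwise
(`exp τ = 1`) and shifting a logarithm: `θ ℓ = ℓ + q • τ`, where `exp ℓ` is algebraic over the
Γ-field `ℚ(gens X)` but `ℓ` is not.

* **`exists_iterate_apply_eq_self_of_semiInvariant`** — if `c ≠ 0` is algebraic over
  `ℚ(gens (X + ℚℓ))` and SEMI-INVARIANT, `θ c = exp w * c` with `w ∈ X + ℚℓ`, then `c` has a finite
  `θ`-orbit: `θ^[M] c = c` for some `M ≥ 1`.
  Proof: for a suitable iterate `Θ = θ^[n]` one has `Θ c = u c` with `u` in the pointwise `Θ`-fixed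
  field `F₂ = ℚ(gens X, exp ℓ)`, over which `ℓ` is transcendental; the constant coefficient `a₀` of
  the minimal polynomial of `c` over `K = F₂(ℓ)` satisfies `Θ a₀ = u^d a₀` (file 3); writing
  `a₀ = P(ℓ)/Q(ℓ)` this is the polynomial identity `u^d P(T) Q(T + α) = P(T + α) Q(T)` over `F₂`, and
  comparing leading coefficients gives `u^d = 1`, whence `Θ^[d] c = c`.
-/

noncomputable section

set_option linter.dupNamespace false

open Set Polynomial
open scoped BigOperators
open Literature.ModelTheory.ExponentialFields Literature.ModelTheory.ExponentialFields.ExponentialRing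
open Literature.NumberTheory.Transcendental Literature.NumberTheory.Transcendental.GammaField

namespace Summit.Schanuel.Schanuel.Theorems.RigidCore

namespace CaseIICore

variable {E : Type*} [Field E] [CharZero E] [ExponentialRing E]

omit [ExponentialRing E] in
/-- An element of `acl s` is algebraic over every subfield containing `s`. [folklore] -/
theorem isAlgebraic_subfield_of_mem_acl (L : Subfield E) {s : Set E} (hs : s ⊆ (L : Set E))
    {a : E} (ha : a ∈ acl s) : IsAlgebraic L a := by
  rw [mem_acl_iff] at ha
  have hsub : ((Algebra.adjoin ℚ s : Subalgebra ℚ E) : Set E) ⊆ (L : Set E) :=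
    CaseIILstep.coe_adjoin_rat_subset_of_subset L hs
  obtain ⟨p, hp0, hcoef, hroot⟩ :=
    (CaseIILstep.isAlgebraic_iff_exists_coeff_mem (T := Algebra.adjoin ℚ s)
      (T₀ := ((Algebra.adjoin ℚ s : Subalgebra ℚ E) : Set E))
      (fun y hy => ⟨⟨y, hy⟩, rfl⟩) (fun t => t.2) (fun _ _ e => Subtype.ext e)).1 ha
  exact (CaseIILstep.isAlgebraic_iff_exists_coeff_mem (T := L) (T₀ := (L : Set E))
    (fun y hy => ⟨⟨y, hy⟩, rfl⟩) (fun t => t.2) (fun _ _ e => Subtype.ext e)).2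
    ⟨p, hp0, fun n => hsub (hcoef n), hroot⟩

omit [CharZero E] [ExponentialRing E] in
/-- Elements of `F₂(ℓ)` are fractions of polynomial values at `ℓ`. [folklore] -/
theorem exists_polyFraction_of_mem_closure (F₂ : Subfield E) (ℓ : E) {z : E}
    (hz : z ∈ Subfield.closure ((F₂ : Set E) ∪ {ℓ})) :
    ∃ P Q : Polynomial F₂, aeval ℓ Q ≠ 0 ∧ z * aeval ℓ Q = aeval ℓ P := by
  induction hz using Subfield.closure_induction with
  | mem x hx =>
    rcases hx with hx | hx
    · refine ⟨C ⟨x, hx⟩, 1, by rw [map_one]; exact one_ne_zero, ?_⟩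
      rw [map_one, mul_one, aeval_C]; rfl
    · rw [mem_singleton_iff] at hx
      subst hx
      exact ⟨X, 1, by rw [map_one]; exact one_ne_zero, by rw [map_one, mul_one, aeval_X]⟩
  | one => exact ⟨1, 1, by rw [map_one]; exact one_ne_zero, by rw [map_one, mul_one]⟩
  | add x y _ _ hx hy =>
    obtain ⟨P₁, Q₁, hQ₁, h₁⟩ := hx
    obtain ⟨P₂, Q₂, hQ₂, h₂⟩ := hy
    refine ⟨P₁ * Q₂ + P₂ * Q₁, Q₁ * Q₂, by rw [map_mul]; exact mul_ne_zero hQ₁ hQ₂, ?_⟩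
    rw [map_mul, map_add, map_mul, map_mul, ← h₁, ← h₂]; ring
  | neg x _ hx =>
    obtain ⟨P, Q, hQ, h⟩ := hx
    exact ⟨-P, Q, hQ, by rw [map_neg, ← h]; ring⟩
  | inv x _ hx =>
    obtain ⟨P, Q, hQ, h⟩ := hx
    by_cases hx0 : x = 0
    · refine ⟨0, 1, by rw [map_one]; exact one_ne_zero, ?_⟩
      rw [hx0, inv_zero, zero_mul, map_zero]
    · have hP : aeval ℓ P ≠ 0 := by rw [← h]; exact mul_ne_zero hx0 hQ
      refine ⟨Q, P, hP, ?_⟩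
      rw [← h, ← mul_assoc, inv_mul_cancel₀ hx0, one_mul]
  | mul x y _ _ hx hy =>
    obtain ⟨P₁, Q₁, hQ₁, h₁⟩ := hx
    obtain ⟨P₂, Q₂, hQ₂, h₂⟩ := hy
    refine ⟨P₁ * P₂, Q₁ * Q₂, by rw [map_mul]; exact mul_ne_zero hQ₁ hQ₂, ?_⟩
    rw [map_mul, map_mul, ← h₁, ← h₂]; ring

omit [CharZero E] [ExponentialRing E] in
/-- A ring automorphism fixing the coefficient field acts on polynomial values through the
argument: `Θ (P(ℓ)) = P(Θ ℓ)`. [folklore] -/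
theorem apply_aeval_of_forall_fixed (Θ : E ≃+* E) (F₂ : Subfield E) (hfix : ∀ a ∈ F₂, Θ a = a)
    (ℓ : E) (P : Polynomial F₂) : Θ (aeval ℓ P) = aeval (Θ ℓ) P := by
  rw [aeval_eq_sum_range, aeval_eq_sum_range, map_sum]
  refine Finset.sum_congr rfl fun i _ => ?_
  rw [Algebra.smul_def, Algebra.smul_def, map_mul, map_pow,
    show algebraMap F₂ E (P.coeff i) = (P.coeff i : E) from rfl, hfix _ (P.coeff i).2]

/-- **Semi-invariant affine kill: finite orbits.**  See the module docstring. [folklore] -/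
theorem exists_iterate_apply_eq_self_of_semiInvariant (θ : E ≃+* E)
    (hθ : ∀ x, θ (exp x) = exp (θ x))
    {X : Submodule ℚ E} (hX : ∀ x ∈ X, θ x = x) {τ : E} (hτX : τ ∈ X) (hτ1 : exp τ = 1)
    {q : ℚ} {ℓ : E} (hθℓ : θ ℓ = ℓ + q • τ)
    (hℓexp : exp ℓ ∈ acl (gens X)) (hℓ : ℓ ∉ acl (gens X))
    {c : E} (hc : c ∈ acl (gens (X ⊔ Submodule.span ℚ {ℓ}))) (hc0 : c ≠ 0)
    {w : E} (hw : w ∈ X ⊔ Submodule.span ℚ {ℓ}) (hsemi : θ c = exp w * c) :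
    ∃ M : ℕ, 0 < M ∧ θ^[M] c = c := by
  classical
  -- write `w = x + r • ℓ`
  obtain ⟨x, hx, rl, hrl, rfl⟩ := Submodule.mem_sup.1 hw
  obtain ⟨r, rfl⟩ := Submodule.mem_span_singleton.1 hrl
  have hθsmul : ∀ (a : ℚ) (v : E), θ (a • v) = a • θ v := fun a v => map_rat_smul θ.toAddMonoidHom a v
  have hθτ : θ τ = τ := hX τ hτX
  have hqτ : θ (q • τ) = q • τ := by rw [hθsmul, hθτ]
  -- the iterates: `θ^[i] c = exp (W i) * c`
  set W : ℕ → E := fun i => (i : ℚ) • x + ((i : ℚ) * r) • ℓ + (r * q * ((i : ℚ) * ((i : ℚ) - 1) / 2)) • τ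
    with hWdef
  have hWsucc : ∀ i, θ (W i) + (x + r • ℓ) = W (i + 1) := by
    intro i
    simp only [hWdef, map_add, hθsmul, hX x hx, hθτ, hθℓ, smul_add, Nat.cast_succ]
    simp only [Rat.smul_def]
    push_cast
    ring
  have hW : ∀ i, θ^[i] c = exp (W i) * c := by
    intro i
    induction i with
    | zero => simp [hWdef]
    | succ i ih =>
      rw [Function.iterate_succ_apply', ih, map_mul, hθ, hsemi, ← mul_assoc, ← exp_add, hWsucc]
  -- the good iterate `Θ = θ^[n]`, `n = r.den * q.den`
  set n : ℕ := r.den * q.den with hndef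
  have hn : 0 < n := Nat.mul_pos r.den_pos q.den_pos
  obtain ⟨Θ, hΘ, hΘexp⟩ := exists_ringEquiv_iterate θ hθ n
  have hnr : ((n : ℚ) * r) = ((r.num * q.den : ℤ) : ℚ) := by
    rw [hndef]; push_cast
    have := Rat.mul_den_eq_num r
    linear_combination (q.den : ℚ) * this
  have hnq : ((n : ℚ) * q) = ((q.num * r.den : ℤ) : ℚ) := by
    rw [hndef]; push_cast
    have := Rat.mul_den_eq_num q
    linear_combination (r.den : ℚ) * this
  -- `exp` of integer multiples of `τ` is `1`
  have hexpzτ : ∀ m : ℤ, exp ((m : ℚ) • τ) = 1 := fun m => by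
    rw [Int.cast_smul_eq_zsmul ℚ, exp_zsmul, hτ1, one_zpow]
  -- `Θ ℓ = ℓ + α`, `α = (n q) • τ ∈ X`, and `Θ (exp ℓ) = exp ℓ`
  have hΘℓ : Θ ℓ = ℓ + ((n : ℚ) * q) • τ := by
    rw [hΘ, iterate_apply_branch θ hqτ hθℓ n, mul_smul, Nat.cast_smul_eq_nsmul, nsmul_eq_mul]
  have hαX : ((n : ℚ) * q) • τ ∈ X := X.smul_mem _ hτX
  have hΘexpℓ : Θ (exp ℓ) = exp ℓ := by
    rw [hΘexp, hΘℓ, exp_add, hnq, hexpzτ, mul_one]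
  have hΘX : ∀ v ∈ X, Θ v = v := fun v hv => by rw [hΘ]; exact iterate_apply_eq_self θ (hX v hv) n
  -- the pointwise `Θ`-fixed field `F₂ = ℚ(gens X, exp ℓ)`
  set F₂ : Subfield E := Subfield.closure (gens X ∪ {exp ℓ}) with hF₂def
  have hF₂fix : ∀ a ∈ F₂, Θ a = a := by
    intro a ha
    have h := RingHom.eqOn_field_closure (f := Θ.toRingHom) (g := RingHom.id E)
      (s := gens X ∪ {exp ℓ}) ?_ ha
    · simpa using h
    · rintro v (hv | hv)
      · rcases (mem_gens_iff.1 hv) with hv | ⟨v', hv', rfl⟩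
        · exact hΘX v hv
        · show Θ (exp v') = exp v'
          rw [hΘexp, hΘX v' hv']
      · rw [mem_singleton_iff] at hv
        subst hv
        exact hΘexpℓ
  have hF₂acl : (F₂ : Set E) ⊆ acl (gens X) := by
    obtain ⟨L, hL⟩ := CaseIILstep.exists_subfield_coe_eq_acl (gens X)
    rw [← hL]
    refine (Subfield.closure_le.2 ?_ : F₂ ≤ L)
    rintro v (hv | hv)
    · rw [SetLike.mem_coe, ← SetLike.mem_coe, hL]; exact subset_acl _ hv
    · rw [mem_singleton_iff] at hv
      subst hv
      rw [SetLike.mem_coe, ← SetLike.mem_coe, hL]; exact hℓexp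
  have hgensF₂ : gens X ⊆ (F₂ : Set E) := fun v hv => Subfield.subset_closure (Or.inl hv)
  -- `ℓ` is transcendental over `F₂`: `aeval ℓ` is injective on `F₂[T]`
  have hinj : ∀ P : Polynomial F₂, aeval ℓ P = 0 → P = 0 := by
    intro P hP
    by_contra hP0
    apply hℓ
    rw [CaseIILstep.mem_acl_iff_exists_coeff_mem]
    refine ⟨P.map (algebraMap F₂ E), (Polynomial.map_ne_zero_iff (algebraMap F₂ E).injective).2 hP0,
      fun i => ?_, ?_⟩
    · rw [coeff_map]; exact hF₂acl (P.coeff i).2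
    · rw [IsRoot.def, eval_map, ← aeval_def, hP]
  -- `u = exp (W n) ∈ F₂`, `Θ c = u * c`, `Θ u = u`
  have hWn : W n = ((n : ℚ) • x + (r * q * ((n : ℚ) * ((n : ℚ) - 1) / 2)) • τ) +
      ((r.num * q.den : ℤ) : ℚ) • ℓ := by
    simp only [hWdef, hnr]; abel
  have huF₂ : exp (W n) ∈ F₂ := by
    rw [hWn, exp_add, Int.cast_smul_eq_zsmul ℚ, exp_zsmul]
    refine mul_mem (hgensF₂ (exp_mem_gens (X.add_mem (X.smul_mem _ hx) (X.smul_mem _ hτX)))) ?_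
    exact F₂.zpow_mem (Subfield.subset_closure (Or.inr rfl)) _
  have hΘc : Θ c = exp (W n) * c := by rw [hΘ, hW n]
  have hΘu : Θ (exp (W n)) = exp (W n) := hF₂fix _ huF₂
  -- the `Θ`-stable field `K = F₂(ℓ)` over which `c` is algebraic
  have hτF₂ : τ ∈ F₂ := hgensF₂ (mem_gens_of_mem hτX)
  have hratF₂ : ∀ (a : ℚ) (v : E), v ∈ F₂ → a • v ∈ F₂ := fun a v hv => by
    rw [Rat.smul_def]; exact mul_mem (SubfieldClass.ratCast_mem F₂ a) hv
  have hαF₂ : ((n : ℚ) * q) • τ ∈ F₂ := hratF₂ _ _ hτF₂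
  set K : Subfield E := Subfield.closure ((F₂ : Set E) ∪ {ℓ}) with hKdef
  have hF₂K : F₂ ≤ K := fun v hv => Subfield.subset_closure (Or.inl hv)
  have hℓK : ℓ ∈ K := Subfield.subset_closure (Or.inr rfl)
  have himage : ∀ φ : E ≃+* E, (∀ a ∈ F₂, φ a = a) → φ ℓ ∈ K → ∀ z ∈ K, φ z ∈ K := by
    intro φ hφF₂ hφℓ z hz
    have hmap : (K.map φ.toRingHom) ≤ K := by
      rw [hKdef, RingHom.map_field_closure]
      refine Subfield.closure_le.2 ?_
      rintro _ ⟨v, hv | hv, rfl⟩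
      · rw [RingEquiv.toRingHom_eq_coe, RingHom.coe_coe, hφF₂ v hv]; exact hF₂K hv
      · rw [mem_singleton_iff] at hv
        subst hv
        exact hφℓ
    exact hmap ⟨z, hz, rfl⟩
  have hK : ∀ z, z ∈ K ↔ Θ z ∈ K := by
    have hsymmF₂ : ∀ a ∈ F₂, Θ.symm a = a := fun a ha => by
      apply Θ.injective; rw [Θ.apply_symm_apply, hF₂fix a ha]
    have hsymmℓ : Θ.symm ℓ = ℓ - ((n : ℚ) * q) • τ := by
      apply Θ.injective
      rw [Θ.apply_symm_apply, map_sub, hΘℓ, hF₂fix _ hαF₂, add_sub_cancel_right]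
    intro z
    constructor
    · exact himage Θ hF₂fix (by rw [hΘℓ]; exact add_mem hℓK (hF₂K hαF₂)) z
    · intro hz
      have := himage Θ.symm hsymmF₂ (by rw [hsymmℓ]; exact sub_mem hℓK (hF₂K hαF₂)) _ hz
      rwa [Θ.symm_apply_apply] at this
  -- `c` is algebraic over `K`
  have hVK : ∀ v ∈ X ⊔ Submodule.span ℚ {ℓ}, v ∈ K := by
    intro v hv
    obtain ⟨x', hx', rl', hrl', rfl⟩ := Submodule.mem_sup.1 hv
    obtain ⟨r', rfl⟩ := Submodule.mem_span_singleton.1 hrl'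
    refine add_mem (hF₂K (hgensF₂ (mem_gens_of_mem hx'))) ?_
    rw [Rat.smul_def]; exact mul_mem (SubfieldClass.ratCast_mem K r') hℓK
  have hcK : IsAlgebraic K c := by
    apply isAlgebraic_subfield_of_mem_acl K (s := (K : Set E)) subset_rfl
    refine acl_subset_acl_of_subset ?_ hc
    intro v hv
    rcases mem_gens_iff.1 hv with hv | ⟨v', hv', rfl⟩
    · exact subset_acl _ (hVK v hv)
    · obtain ⟨x', hx', rl', hrl', rfl⟩ := Submodule.mem_sup.1 hv'
      obtain ⟨r', rfl⟩ := Submodule.mem_span_singleton.1 hrl'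
      rw [exp_add]
      refine mul_mem_acl (subset_acl _ (hF₂K (hgensF₂ (exp_mem_gens hx')))) ?_
      refine mem_acl_of_pow_mem r'.den_pos.ne' ?_
      have hpow : exp (r' • ℓ) ^ r'.den = exp ℓ ^ r'.num := by
        rw [← exp_nsmul, ← Nat.cast_smul_eq_nsmul ℚ, smul_smul,
          show ((r'.den : ℚ) * r') = ((r'.num : ℤ) : ℚ) by rw [mul_comm]; exact Rat.mul_den_eq_num r',
          Int.cast_smul_eq_zsmul ℚ, exp_zsmul]
      rw [hpow]
      exact subset_acl _ (K.zpow_mem (hF₂K (Subfield.subset_closure (Or.inr rfl))) _)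
  have hci : IsIntegral K c := hcK.isIntegral
  -- the constant coefficient of the minimal polynomial is semi-invariant
  have hu0 : exp (W n) ≠ 0 := exp_ne_zero _
  obtain ⟨hA, -⟩ := coeff_zero_minpoly_semi Θ K hK hci (hF₂K huF₂) hu0 hΘc
  have hdpos : 0 < (minpoly K c).natDegree := minpoly.natDegree_pos hci
  have ha₀0 : (((minpoly K c).coeff 0 : K) : E) ≠ 0 := fun h =>
    minpoly.coeff_zero_ne_zero hci hc0 (ZeroMemClass.coe_eq_zero.1 h)
  -- `a₀ = P(ℓ)/Q(ℓ)`
  obtain ⟨P, Q, hQ, hPQ⟩ := exists_polyFraction_of_mem_closure F₂ ℓ ((minpoly K c).coeff 0).2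
  have hP0 : P ≠ 0 := by
    rintro rfl
    rw [map_zero] at hPQ
    exact (mul_ne_zero ha₀0 hQ) hPQ
  have hQ0 : Q ≠ 0 := by rintro rfl; exact hQ (map_zero _)
  have hΘQ : Θ (aeval ℓ Q) = aeval (ℓ + ((n : ℚ) * q) • τ) Q := by
    rw [apply_aeval_of_forall_fixed Θ F₂ hF₂fix, hΘℓ]
  have hΘP : Θ (aeval ℓ P) = aeval (ℓ + ((n : ℚ) * q) • τ) P := by
    rw [apply_aeval_of_forall_fixed Θ F₂ hF₂fix, hΘℓ]
  -- the identity `u^d P(ℓ) Q(ℓ + α) = P(ℓ + α) Q(ℓ)`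
  have hval : exp (W n) ^ (minpoly K c).natDegree * aeval ℓ P * aeval (ℓ + ((n : ℚ) * q) • τ) Q =
      aeval (ℓ + ((n : ℚ) * q) • τ) P * aeval ℓ Q := by
    have h1 := congrArg Θ hPQ
    rw [map_mul, hA, hΘQ, hΘP] at h1
    rw [← h1, ← hPQ]
    ring
  -- as an identity of polynomials over `F₂`
  set uF : F₂ := ⟨exp (W n), huF₂⟩ with huFdef
  set αF : F₂ := ⟨((n : ℚ) * q) • τ, hαF₂⟩ with hαFdef
  have hsh : aeval ℓ (Polynomial.X + C αF) = ℓ + ((n : ℚ) * q) • τ := by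
    rw [map_add, aeval_X, aeval_C]; rfl
  have hpoly : C (uF ^ (minpoly K c).natDegree) * P * Q.comp (Polynomial.X + C αF) = P.comp (Polynomial.X + C αF) * Q := by
    have hdiff := hinj (C (uF ^ (minpoly K c).natDegree) * P * Q.comp (Polynomial.X + C αF) -
      P.comp (Polynomial.X + C αF) * Q) ?_
    · exact sub_eq_zero.1 hdiff
    · rw [map_sub, sub_eq_zero, map_mul, map_mul, map_mul, aeval_C, map_pow, aeval_comp, aeval_comp, hsh,
        show algebraMap F₂ E uF = exp (W n) from rfl]
      exact hval
  -- compare leading coefficients: `u^d = 1`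
  have hnd : (Polynomial.X + C αF).natDegree ≠ 0 := by rw [natDegree_X_add_C]; exact one_ne_zero
  have hlc := congrArg leadingCoeff hpoly
  rw [leadingCoeff_mul, leadingCoeff_mul, leadingCoeff_C, leadingCoeff_comp hnd, leadingCoeff_mul,
    leadingCoeff_comp hnd, leadingCoeff_X_add_C] at hlc
  simp only [one_pow, mul_one] at hlc
  have hlcP : P.leadingCoeff ≠ 0 := leadingCoeff_ne_zero.2 hP0
  have hlcQ : Q.leadingCoeff ≠ 0 := leadingCoeff_ne_zero.2 hQ0
  have hud : uF ^ (minpoly K c).natDegree = 1 :=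
    mul_right_cancel₀ (mul_ne_zero hlcP hlcQ) (by rw [one_mul, ← mul_assoc]; exact hlc)
  have hudE : exp (W n) ^ (minpoly K c).natDegree = 1 := by
    have := congrArg (fun z : F₂ => (z : E)) hud
    simpa [huFdef] using this
  -- iterate `Θ`
  have hΘiter : ∀ i, Θ^[i] c = exp (W n) ^ i * c := by
    intro i
    induction i with
    | zero => simp
    | succ i ih =>
      rw [Function.iterate_succ_apply', ih, map_mul, map_pow, hΘu, hΘc, pow_succ]
      ring
  refine ⟨n * (minpoly K c).natDegree, Nat.mul_pos hn hdpos, ?_⟩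
  have hfun : (Θ : E → E) = θ^[n] := funext hΘ
  rw [Function.iterate_mul, ← hfun, hΘiter, hudE, one_mul]

end CaseIICore

/-! ### Registered helper (crux stub list of stmt-Schanuel-0968) -/

/-- **Registered form of `CaseIICore.exists_iterate_apply_eq_self_of_semiInvariant`** (all binders
explicit): semi-invariant constants of the bottom level have finite `θ`-orbit. [folklore] -/
theorem caseII_exists_iterate_apply_eq_self_of_semiInvariant {E : Type*} [Field E] [CharZero E]
    [ExponentialRing E] (θ : E ≃+* E) (hθ : ∀ x, θ (exp x) = exp (θ x))
    {X : Submodule ℚ E} (hX : ∀ x ∈ X, θ x = x) {τ : E} (hτX : τ ∈ X) (hτ1 : exp τ = 1)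
    {q : ℚ} {ℓ : E} (hθℓ : θ ℓ = ℓ + q • τ)
    (hℓexp : exp ℓ ∈ acl (gens X)) (hℓ : ℓ ∉ acl (gens X))
    {c : E} (hc : c ∈ acl (gens (X ⊔ Submodule.span ℚ {ℓ}))) (hc0 : c ≠ 0)
    {w : E} (hw : w ∈ X ⊔ Submodule.span ℚ {ℓ}) (hsemi : θ c = exp w * c) :
    ∃ M : ℕ, 0 < M ∧ θ^[M] c = c :=
  CaseIICore.exists_iterate_apply_eq_self_of_semiInvariant θ hθ hX hτX hτ1 hθℓ hℓexp hℓ hc hc0 hw hsemi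

end Summit.Schanuel.Schanuel.Theorems.RigidCore
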